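import Literature.NumberTheory.EllipticCurves.GeomPointsGaloisModule
import Mathlib.NumberTheory.NumberField.Completion.InfinitePlace
import Mathlib.NumberTheory.NumberField.InfinitePlace.TotallyRealComplex
import Literature.AlgebraicGeometry.Motives.TateSubspaceRealizationObstruction
import HarnessLib

/-!
# `#H¹(K_w, M) = 1` at a complex place, and all infinite places of an extension of a totally complex field are complex
# (crux ♭T′ stmt-BirchSwinnertonDyer-26975, line `sigmacongruence`, brick (1b″) of the growth road to stub TS1:
# the archimedean factor `∏_{w∣∞ of K_n} #H¹(K_{n,w}, E)` of the layer count `exists_finset_selmerAc_torsion_invariant_card_ge` is `1`)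

Route `UniversalToricDescent`, lead prover `bsd-wall-utd-p1` g15. THEOREMS ONLY; `--supports stmt-BirchSwinnertonDyer-26975`.
BSD is not proved by any of this.

* `subsingleton_absoluteGaloisGroup_completion_of_isComplex` — `K_w ≃ ℂ` is algebraically closed, so `Γ_{K_w}` is trivial;
* `natCard_galoisCohomology_one_eq_one_of_subsingleton` — `H¹_cont(Γ, M) = 0` for a trivial group `Γ` (every class is represented by a
  continuous cocycle, `oneCocycleClass_surjective`, and a cocycle on the trivial group vanishes: `φ(1) = φ(1·1) = φ(1) + 1•φ(1)`);
* `natCard_localH1_eq_one_of_isComplex` — `#H¹(K_w, M) = 1` for every discrete `Γ_{K_w}`-module at a complex place `w`;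
* `isComplex_of_isTotallyComplex_base` — every infinite place of a finite extension `L/K` of a totally complex `K` is complex;
* `prod_natCard_localH1_infinitePlace_eq_one` — `∏_{w∣∞ of L} #H¹(L_w, M_w) = 1` for such `L`.

References: [NeukirchSchmidtWingberg2008] (1.6.2); [GreenbergLNM1716] §3 p. 87 (archimedean primes of a totally complex field).
-/

set_option autoImplicit false
-- the Theorems namespace of this sub repeats the summit name by design (D-0017 nested layout)
set_option linter.dupNamespace false

noncomputable section

open scoped Classical
open NumberField Literature.NumberTheory.GaloisRepresentations Literature.NumberTheory.EllipticCurves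

universe u v

namespace Summit.BirchSwinnertonDyer.BirchSwinnertonDyer.Theorems.UniversalToricDescentComplexPlaceH1

/-- **`Γ_{K_w}` is trivial at a complex place `w`** (`K_w ≃ ℂ` is algebraically closed). [cite: NeukirchSchmidtWingberg2008, (1.6.2)] -/
theorem subsingleton_absoluteGaloisGroup_completion_of_isComplex {K : Type} [Field K] [NumberField K]
    {w : InfinitePlace K} (hw : w.IsComplex) : Subsingleton (Field.absoluteGaloisGroup w.Completion) := by
  haveI : IsAlgClosed w.Completion :=
    IsAlgClosed.of_ringEquiv _ _ (InfinitePlace.Completion.ringEquivComplexOfIsComplex hw).symm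
  exact Literature.AlgebraicGeometry.Motives.subsingleton_absoluteGaloisGroup_of_isAlgClosed _

/-- **`H¹_cont(Γ, X) = 0` for a trivial topological group `Γ`** (any topological `R[Γ]`-module `X`): a continuous `1`-cocycle
`φ` has `φ(1) = 0` (`contOneCocycles.apply_one`), and every class is represented by a cocycle (`oneCocycleClass_surjective`).
[cite: NeukirchSchmidtWingberg2008, (1.6.2)] -/
theorem natCard_continuousCohomology_one_eq_one_of_subsingleton {R : Type v} [Ring R] [TopologicalSpace R]
    {G : Type u} [Group G] [TopologicalSpace G] [IsTopologicalGroup G] (hG : Subsingleton G) (X : TopRep.{u} R G) :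
    Nat.card (continuousCohomology 1 X) = 1 := by
  rw [Nat.card_eq_one_iff_unique]
  refine ⟨⟨fun a b ↦ ?_⟩, ⟨0⟩⟩
  obtain ⟨φ, rfl⟩ := oneCocycleClass_surjective _ a
  obtain ⟨ψ, rfl⟩ := oneCocycleClass_surjective _ b
  have hzero : ∀ χ : contOneCocycles X, χ = 0 := fun χ ↦ by
    apply Subtype.ext
    ext g
    rw [@Subsingleton.elim G hG g 1]
    exact contOneCocycles.apply_one χ
  rw [hzero φ, hzero ψ]

/-- **`#H¹(k, M) = 1` when `Γ_k` is trivial** (e.g. `k = K_w` at a complex place), for every discrete `Γ_k`-module `M`.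
[cite: NeukirchSchmidtWingberg2008, (1.6.2)] -/
theorem natCard_galoisCohomology_one_eq_one_of_subsingleton {k : Type u} [Field k] (hk : Subsingleton (Field.absoluteGaloisGroup k))
    {M : Type u} [AddCommGroup M] [TopologicalSpace M] [DiscreteTopology M] (ρ : DiscreteGaloisModule k M) :
    Nat.card (galoisCohomology ρ 1) = 1 := by
  delta galoisCohomology
  exact natCard_continuousCohomology_one_eq_one_of_subsingleton hk _

/-- **`#H¹(K_w, M) = 1` at a complex place `w`** of a number field, for every discrete `Γ_{K_w}`-module `M` (in particular
`M = E(K̄_w)`: the archimedean factors of the finite-level Selmer counts vanish at complex places).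
[cite: GreenbergLNM1716, §3 p. 87] [cite: NeukirchSchmidtWingberg2008, (1.6.2)] -/
theorem natCard_localH1_eq_one_of_isComplex {K : Type} [Field K] [NumberField K] {w : InfinitePlace K} (hw : w.IsComplex)
    {M : Type} [AddCommGroup M] [TopologicalSpace M] [DiscreteTopology M] (ρ : DiscreteGaloisModule w.Completion M) :
    Nat.card (galoisCohomology ρ 1) = 1 := by
  exact natCard_galoisCohomology_one_eq_one_of_subsingleton (subsingleton_absoluteGaloisGroup_completion_of_isComplex hw) ρ

/-- **All archimedean factors vanish over a totally complex field**: `∏_{w∣∞} #H¹(K_w, M_w) = 1` for any family of discrete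
modules at the infinite completions of a totally complex number field `K` (e.g. every layer `K_n` of a `ℤ_p`-extension of an
imaginary quadratic field: `NumberField.isTotallyComplex_of_algebra`). [cite: GreenbergLNM1716, §3 p. 87] -/
theorem prod_natCard_localH1_infinitePlace_eq_one {K : Type} [Field K] [NumberField K] [IsTotallyComplex K]
    {Mw : InfinitePlace K → Type} [∀ w, AddCommGroup (Mw w)] [∀ w, TopologicalSpace (Mw w)] [∀ w, DiscreteTopology (Mw w)]
    (ρ : ∀ w : InfinitePlace K, DiscreteGaloisModule w.Completion (Mw w)) :
    ∏ w : InfinitePlace K, Nat.card (galoisCohomology (ρ w) 1) = 1 :=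
  Finset.prod_eq_one fun w _ ↦ natCard_localH1_eq_one_of_isComplex (IsTotallyComplex.isComplex w) (ρ w)

/-- The archimedean factor of the layer count `exists_finset_selmerAc_torsion_invariant_card_ge` (Theorems/…LayerRelaxedGrowth) is `1`
over a totally complex layer field: `∏_{w∣∞ of L} #H¹(L_w, E_L(L̄_w)) = 1`. [cite: GreenbergLNM1716, §3 p. 87] -/
theorem prod_natCard_localH1_localGaloisModule_eq_one {L : Type} [Field L] [NumberField L] [IsTotallyComplex L]
    (W : WeierstrassCurve L) :
    ∏ w : InfinitePlace L, Nat.card (galoisCohomology (W.localGaloisModule w.Completion) 1) = 1 :=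
  prod_natCard_localH1_infinitePlace_eq_one fun w ↦ W.localGaloisModule w.Completion

end Summit.BirchSwinnertonDyer.BirchSwinnertonDyer.Theorems.UniversalToricDescentComplexPlaceH1

end
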